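import Summits.NavierStokesRegularity.NavierStokesRegularity.Theses.AxisymmetricExtremality
import Summits.NavierStokesRegularity.NavierStokesRegularity.Theorems.AxisymmetricExtremalityAxisymmetricKatoGlobalStubSeregin2020TypeIILemma22VeryWeakOffAxis
import Summits.NavierStokesRegularity.NavierStokesRegularity.Theorems.AxisymmetricExtremalityAxisymmetricKatoGlobalStubSeregin2020TypeIILemma22LaplacianDuality
import Summits.NavierStokesRegularity.NavierStokesRegularity.Theorems.AxisymmetricExtremalityAxisymmetricKatoGlobalStubSeregin2020TypeIILemma22AxisTermSpaceTime
import Summits.NavierStokesRegularity.NavierStokesRegularity.Theorems.AxisymmetricExtremalityAxisymmetricKatoGlobalStubSeregin2020TypeIILemma22DriftCommutator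
import HarnessLib

/-!
# Seregin 2020, Lemma 2.2 (after Nazarov–Uraltseva 2012): the very weak form of (2.12) WITH THE
# AXIS TERM, `∫∫ Φ (-∂ₜη - Δη - (U + 2x'/|x'|²)·∇η) dx dt ≥ 4π ∫∫ Φ η|_{x'=0} dx₃ dt`

Helper toward the stub `stub_seregin2020TypeII` of the crux `AxisymmetricKatoGlobal` (= the named
fact `Literature.Analysis.FluidPDE.Seregin2020_axisymmetricSingularPoint_typeII`, G. Seregin,
Anal. Math. Phys. 10 (2020) Paper 46 = arXiv:2006.04140, Thm 2.1), reduced this session to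
Lemma 2.2 of the paper in the corrected rendering `hWH′` (SUPERsolutions of (2.12), cf.
`not_weakHarnack_subsolution`). Its printed proof (arXiv p. 8) reads: "The proof of the lemma is
based on the inequality
`∫_{B(R)×]-R²,-3R²/4[} (∂ₜπ η + ∇π·∇η - (u + 2x'/|x'|²)·∇η π) dx dt ≥ 4π₀ ∫ π η dx₃ dt`
for any test function `η` being equal to zero near spatial boundary. Here, `π₀ = 3.14...`. One
can easily verify that the above inequality is still true for functions `π` from the class 𝒱."
This is Nazarov–Uraltseva's (4.5), the weak form of `∂ₜπ + b·∇π - Δπ ≥ 0` once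
`div b = div(u + 2x'/|x'|²) = 4π₀ δ_{axis}` ((4.3)) is used. This file PROVES it (piece P5 of the
session frontier) for the class of `hWH′`, for nonnegative space–time test functions `η` supported
in the regular set (`tsupport η ⊆ W`, `W` open; in `hWH′`, `W = Q₋ ∖ S`), fully integrated by
parts onto `η` (the form consumed by N–U's (4.6)–(4.8)):

* `veryWeak_supersolution_axis` —
  `4π ∫∫ Φ(t,(0,0,x₃)) η(t,(0,0,x₃)) dx₃ dt ≤ -∫∫ Φ ∂ₜη - ∫∫ Φ Dη[U] - ∫∫ Φ (2/ϱ)∂_ϱη - ∫∫ Φ Δη`.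

Proof (the files `…Lemma22VeryWeakOffAxis`, `…AxisCutoffTest`, `…AxisTerm(SpaceTime)`,
`…DriftCommutator`, `…LaplacianDuality`): test the pointwise inequality with `η ψ_ε`, `ψ_ε` the
axis cut-off; move `∂ₜ` and both drifts onto `η ψ_ε` off the axis; expand
`D(ηψ_ε) = ψ_ε Dη + η Dψ_ε`; as `ε → 0` the bulk terms converge by dominated convergence
(`|u| Dη ∈ L¹` since `u ∈ L³`, `(2/ϱ)∂_ϱη ∈ L¹`), the commutator `∫∫ Φ η U·∇ψ_ε → 0`, the viscous
term `∫∫ ΔΦ η ψ_ε → ∫∫ ΔΦ η = ∫∫ Φ Δη` (the class is `C²` across the regular axis), and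
`∫∫ Φ η (2x'/|x'|²)·∇ψ_ε → 2c₂ ∫∫ Φη|_{axis} = 4π ∫∫ Φη|_{axis}` is the axis term.

## References

* G. Seregin, Anal. Math. Phys. 10 (2020), Paper 46 = arXiv:2006.04140, Lemma 2.2 and the
  displayed inequality of its proof (arXiv p. 8). [Seregin2020]
* A. I. Nazarov, N. N. Uraltseva, St. Petersburg Math. J. 23 (2012) 93–115 = arXiv:1011.1888,
  §4, (4.3) `div b = 4πεδ_Γ`, (4.5), Lemma 4.2. [NazarovUraltseva2012]
-/

-- the problem directory repeats the summit name (D-0017); core's `dupNamespace` linter fires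
set_option linter.dupNamespace false

noncomputable section

open MeasureTheory Set Function Filter Topology TopologicalSpace Metric WithLp
open scoped NNReal ENNReal InnerProductSpace RealInnerProductSpace Laplacian

namespace Summit.NavierStokesRegularity.NavierStokesRegularity.Theorems.AxisymmetricKatoGlobal.EulerScaling

open Literature.Analysis.FluidPDE Literature.Analysis.FluidPDE.Seregin2020
  Literature.Analysis.FluidPDE.SereginZajaczkowski2007

/-- A product `f • g` with `f` continuous on an open `W` and `g` continuous vanishing off a
compact `K ⊆ W` is continuous (near points outside `W` it vanishes identically). [folklore] -/
theorem continuous_smul_of_eq_zero_off {M : Type*} [NormedAddCommGroup M] [NormedSpace ℝ M]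
    {W K : Set (ℝ × EuclideanSpace ℝ (Fin 3))} (hW : IsOpen W) (hK : IsCompact K) (hKW : K ⊆ W)
    {f : ℝ × EuclideanSpace ℝ (Fin 3) → ℝ} (hf : ContinuousOn f W) {g : ℝ × EuclideanSpace ℝ (Fin 3) → M}
    (hg : Continuous g) (hg0 : ∀ z, z ∉ K → g z = 0) : Continuous fun z => f z • g z := by
  rw [continuous_iff_continuousAt]
  intro z
  by_cases hz : z ∈ W
  · exact (hf.continuousAt (hW.mem_nhds hz)).smul hg.continuousAt
  · have hzK : z ∉ K := fun h => hz (hKW h)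
    have hev : (fun w => f w • g w) =ᶠ[𝓝 z] fun _ => 0 := by
      filter_upwards [hK.isClosed.isOpen_compl.mem_nhds hzK] with w hw
      rw [hg0 w hw, smul_zero]
    exact continuousAt_const.congr hev.symm

/-- `Φ η` is continuous on `ℝ × ℝ³` and vanishes off `tsupport η`, for `Φ` continuous on the open
set `W` carrying the test function `η`. [folklore] -/
theorem continuous_mul_test_of_continuousOn {W : Opens (ℝ × EuclideanSpace ℝ (Fin 3))}
    {Φ : ℝ → EuclideanSpace ℝ (Fin 3) → ℝ} (hΦc : ContinuousOn (uncurry Φ) (W : Set (ℝ × EuclideanSpace ℝ (Fin 3))))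
    {η : ℝ → EuclideanSpace ℝ (Fin 3) → ℝ} (hη : IsSpaceTimeTestOn W η) :
    Continuous (fun z : ℝ × EuclideanSpace ℝ (Fin 3) => Φ z.1 z.2 * η z.1 z.2) ∧
      ∀ z : ℝ × EuclideanSpace ℝ (Fin 3), z ∉ tsupport (uncurry η) → Φ z.1 z.2 * η z.1 z.2 = 0 := by
  have hη0K : ∀ z : ℝ × EuclideanSpace ℝ (Fin 3), z ∉ tsupport (uncurry η) → η z.1 z.2 = 0 := fun z hz =>
    (image_eq_zero_of_notMem_tsupport hz : uncurry η z = 0)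
  refine ⟨?_, fun z hz => by simp [hη0K z hz]⟩
  have h := continuous_smul_of_eq_zero_off (M := ℝ) W.isOpen hη.hasCompactSupport hη.tsupport_subset
    (f := fun z => Φ z.1 z.2) hΦc (g := fun z => η z.1 z.2) hη.contDiff.continuous hη0K
  simpa only [smul_eq_mul] using h

/-- The restriction `(t, x₃) ↦ F(t, (0, 0, x₃))` to the axis of a continuous compactly supported
`F : ℝ × ℝ³ → ℝ` is integrable on `ℝ × ℝ`. [folklore] -/
theorem integrable_comp_axis {F : ℝ × EuclideanSpace ℝ (Fin 3) → ℝ} (hF : Continuous F) (hFs : HasCompactSupport F) :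
    Integrable (fun p : ℝ × ℝ => F (p.1, meridianPoint (0, p.2))) := by
  obtain ⟨L, hL⟩ := hFs.isCompact.isBounded.subset_closedBall 0
  have hc : Continuous fun p : ℝ × ℝ => F (p.1, meridianPoint (0, p.2)) :=
    hF.comp (continuous_fst.prodMk ((contDiff_meridianPoint (n := (⊤ : ℕ∞))).continuous.comp
      (continuous_const.prodMk continuous_snd)))
  refine hc.integrable_of_hasCompactSupport ?_
  refine HasCompactSupport.intro (isCompact_closedBall (0 : ℝ × ℝ) L) fun p hp => ?_
  refine image_eq_zero_of_notMem_tsupport fun h => hp ?_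
  have h' := hL h
  rw [mem_closedBall, dist_zero_right] at h' ⊢
  have e : ‖((p.1, meridianPoint (0, p.2)) : ℝ × EuclideanSpace ℝ (Fin 3))‖ = ‖p‖ := by
    rw [Prod.norm_def, Prod.norm_def, norm_meridianPoint_zero, Real.norm_eq_abs, Real.norm_eq_abs]
  rwa [e] at h'

/-- **Seregin 2020, proof of Lemma 2.2: the very weak form of the supersolution inequality (2.12)
with the axis term** (= Nazarov–Uraltseva 2012, (4.5), integrated by parts onto the test
function). Setting: `W ⊆ ℝ × ℝ³` open (the regular set `Q₋ ∖ S`); `Φ` continuous on `W` with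
`C²` slices, `∇Φ` and `∂ₑ∂ₑΦ` jointly continuous on `W` (axis points included); off the axis a
classical `∂ₜΦ`, jointly continuous; a drift `U` continuous off the axis with `C¹`
divergence-free slices there and `∫_{tsupport η} ‖U‖³ < ∞`; the SUPERSOLUTION inequality
`0 ≤ ∂ₜΦ + DΦ[U] + (2/ϱ)∂_ϱΦ - ΔΦ` on `W` off the axis; `η ≥ 0` a space–time test function on `W`.
Conclusion:
`4π ∫∫ Φ(t,(0,0,x₃)) η(t,(0,0,x₃)) dx₃ dt ≤ -∫∫ Φ ∂ₜη - ∫∫ Φ Dη[U] - ∫∫ Φ (2/ϱ)∂_ϱη - ∫∫ Φ Δη`,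
i.e. `∫∫ Φ(-∂ₜη - Δη - (U + 2x'/|x'|²)·∇η) ≥ 4π₀ ∫∫ Φη dx₃dt`: the distributional divergence
`div(2x'/|x'|²) = 4π₀ δ_{axis}` of the drift produces the positive axis source from which the
weak Harnack inequality (2.15) propagates the lower bound (2.13).
[cite: Seregin2020, proof of Lemma 2.2 (arXiv p. 8), the displayed inequality with the axis term 4π₀∫πη dx₃dt; NazarovUraltseva2012 (4.5)] -/
theorem veryWeak_supersolution_axis : ∀ (W : Opens (ℝ × EuclideanSpace ℝ (Fin 3)))
    (Φ : ℝ → EuclideanSpace ℝ (Fin 3) → ℝ) (U : ℝ → EuclideanSpace ℝ (Fin 3) → EuclideanSpace ℝ (Fin 3)),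
    ContinuousOn (uncurry Φ) (W : Set (ℝ × EuclideanSpace ℝ (Fin 3))) →
    (∀ z ∈ (W : Set (ℝ × EuclideanSpace ℝ (Fin 3))), ContDiffAt ℝ 2 (Φ z.1) z.2) →
    ContinuousOn (fun z : ℝ × EuclideanSpace ℝ (Fin 3) => fderiv ℝ (Φ z.1) z.2) (W : Set (ℝ × EuclideanSpace ℝ (Fin 3))) →
    (∀ e : EuclideanSpace ℝ (Fin 3), ContinuousOn
      (fun z : ℝ × EuclideanSpace ℝ (Fin 3) => fderiv ℝ (fun y => fderiv ℝ (Φ z.1) y e) z.2 e)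
      (W : Set (ℝ × EuclideanSpace ℝ (Fin 3)))) →
    (∀ z ∈ (W : Set (ℝ × EuclideanSpace ℝ (Fin 3))), cylRadius z.2 ≠ 0 → DifferentiableAt ℝ (fun r => Φ r z.2) z.1) →
    ContinuousOn (fun z : ℝ × EuclideanSpace ℝ (Fin 3) => deriv (fun r => Φ r z.2) z.1)
      ((W : Set (ℝ × EuclideanSpace ℝ (Fin 3))) ∩ {z | cylRadius z.2 ≠ 0}) →
    ContinuousOn (uncurry U) ((W : Set (ℝ × EuclideanSpace ℝ (Fin 3))) ∩ {z | cylRadius z.2 ≠ 0}) →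
    (∀ z ∈ (W : Set (ℝ × EuclideanSpace ℝ (Fin 3))), cylRadius z.2 ≠ 0 → ContDiffAt ℝ 1 (U z.1) z.2) →
    (∀ z ∈ (W : Set (ℝ × EuclideanSpace ℝ (Fin 3))), cylRadius z.2 ≠ 0 → VectorCalculus.divergence (U z.1) z.2 = 0) →
    (∀ z ∈ (W : Set (ℝ × EuclideanSpace ℝ (Fin 3))), cylRadius z.2 ≠ 0 →
      0 ≤ deriv (fun r => Φ r z.2) z.1 + fderiv ℝ (Φ z.1) z.2 (U z.1 z.2) +
        2 / cylRadius z.2 * partialDeriv (eR z.2) (Φ z.1) z.2 - Laplacian.laplacian (Φ z.1) z.2) →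
    ∀ (η : ℝ → EuclideanSpace ℝ (Fin 3) → ℝ), IsSpaceTimeTestOn W η → (∀ t x, 0 ≤ η t x) →
    (∫⁻ z in tsupport (uncurry η), ‖U z.1 z.2‖ₑ ^ (3 : ℕ) < ∞) →
    4 * Real.pi * ∫ p : ℝ × ℝ, Φ p.1 (meridianPoint (0, p.2)) * η p.1 (meridianPoint (0, p.2)) ≤
      -(∫ z : ℝ × EuclideanSpace ℝ (Fin 3), Φ z.1 z.2 * timeDeriv η z.1 z.2)
        - (∫ z : ℝ × EuclideanSpace ℝ (Fin 3), Φ z.1 z.2 * fderiv ℝ (η z.1) z.2 (U z.1 z.2))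
        - (∫ z : ℝ × EuclideanSpace ℝ (Fin 3), Φ z.1 z.2 * (2 / cylRadius z.2 * partialDeriv (eR z.2) (η z.1) z.2))
        - ∫ z : ℝ × EuclideanSpace ℝ (Fin 3), Φ z.1 z.2 * Laplacian.laplacian (η z.1) z.2 := by
  intro W Φ U hΦc hΦs hΦg hΦ2 hΦt hΦt' hUc hUs hdivU hsup η hη hη0 hU3
  have hWo : IsOpen (W : Set (ℝ × EuclideanSpace ℝ (Fin 3))) := W.isOpen
  set K : Set (ℝ × EuclideanSpace ℝ (Fin 3)) := tsupport (uncurry η) with hK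
  have hKc : IsCompact K := hη.hasCompactSupport
  have hKW : K ⊆ (W : Set (ℝ × EuclideanSpace ℝ (Fin 3))) := hη.tsupport_subset
  have hKm : MeasurableSet K := hKc.isClosed.measurableSet
  -- the off-axis part of `W`
  set V : Opens (ℝ × EuclideanSpace ℝ (Fin 3)) := ⟨(W : Set (ℝ × EuclideanSpace ℝ (Fin 3))) ∩ {z | cylRadius z.2 ≠ 0},
    hWo.inter (isOpen_ne_fun (continuous_cylRadius.comp continuous_snd) continuous_const)⟩ with hV
  have hVW : (V : Set (ℝ × EuclideanSpace ℝ (Fin 3))) ⊆ (W : Set (ℝ × EuclideanSpace ℝ (Fin 3))) := fun z hz => hz.1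
  have hVρ : ∀ z ∈ (V : Set (ℝ × EuclideanSpace ℝ (Fin 3))), cylRadius z.2 ≠ 0 := fun z hz => hz.2
  have hΦΔ : ContinuousOn (fun z : ℝ × EuclideanSpace ℝ (Fin 3) => Laplacian.laplacian (Φ z.1) z.2)
      (W : Set (ℝ × EuclideanSpace ℝ (Fin 3))) := continuousOn_laplacian_slice_of_fderiv_fderiv hΦs hΦ2
  -- `F = Φ η`, continuous with compact support, and `D = Dη`
  set F : ℝ × EuclideanSpace ℝ (Fin 3) → ℝ := fun z => Φ z.1 z.2 * η z.1 z.2 with hF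
  obtain ⟨hFc, hF0⟩ : Continuous F ∧ ∀ z, z ∉ K → F z = 0 := continuous_mul_test_of_continuousOn hΦc hη
  have hFs : HasCompactSupport F := HasCompactSupport.intro hKc hF0
  obtain ⟨MF, hMF⟩ : ∃ M, ∀ z, |F z| ≤ M := by
    obtain ⟨M, hM⟩ := hFc.bounded_above_of_compact_support hFs
    exact ⟨M, fun z => by simpa [Real.norm_eq_abs] using hM z⟩
  have hDc : Continuous fun z : ℝ × EuclideanSpace ℝ (Fin 3) => fderiv ℝ (η z.1) z.2 := continuous_fderiv_slice hη
  have hD0 : ∀ z : ℝ × EuclideanSpace ℝ (Fin 3), z ∉ K → fderiv ℝ (η z.1) z.2 = 0 := fun z hz => fderiv_slice_eq_zero_of_notMem hz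
  obtain ⟨CD, hCD⟩ : ∃ C, ∀ z : ℝ × EuclideanSpace ℝ (Fin 3), ‖fderiv ℝ (η z.1) z.2‖ ≤ C :=
    hDc.bounded_above_of_compact_support (HasCompactSupport.intro hKc hD0)
  -- measurability of `Φ` and `U` on `K`, bounds, `‖U‖/ϱ, ‖U‖ ∈ L¹(K)`
  have hΦm : AEStronglyMeasurable (K.indicator fun z : ℝ × EuclideanSpace ℝ (Fin 3) => Φ z.1 z.2) volume :=
    (aestronglyMeasurable_indicator_iff hKm).2 ((hΦc.mono hKW).aestronglyMeasurable hKm)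
  obtain ⟨MΦ, hMΦ⟩ : ∃ M, ∀ z ∈ K, |Φ z.1 z.2| ≤ M := by
    obtain ⟨M, hM⟩ := hKc.exists_bound_of_continuousOn (hΦc.mono hKW)
    exact ⟨M, fun z hz => (by simpa only [Real.norm_eq_abs] using hM z hz : |uncurry Φ z| ≤ M)⟩
  have hUm : AEStronglyMeasurable (K.indicator (uncurry U)) volume :=
    aestronglyMeasurable_indicator_of_continuousOn_offAxis hWo hKc hKW hUc
  obtain ⟨hUρ, hU1⟩ := integrable_norm_div_cylRadius_of_lintegral_cube hKc hUm hU3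
  -- the axis cut-off
  set ψ : ℝ → EuclideanSpace ℝ (Fin 3) → ℝ := fun ε x => Real.smoothTransition (2 / ε * cylRadius x - 1) with hψdef
  have hψ : ∀ ε x, ψ ε x = Real.smoothTransition (2 / ε * cylRadius x - 1) := fun _ _ => rfl
  have hψm : ∀ ε, AEStronglyMeasurable (fun z : ℝ × EuclideanSpace ℝ (Fin 3) => ψ ε z.2) volume := fun ε =>
    (Real.smoothTransition.continuous.comp ((continuous_const.mul (continuous_cylRadius.comp continuous_snd)).sub
      continuous_const)).aestronglyMeasurable
  have hψ1 : ∀ ε, ∀ᵐ z : ℝ × EuclideanSpace ℝ (Fin 3), ‖ψ ε z.2‖ ≤ 1 := fun ε => Eventually.of_forall fun z => by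
    rw [Real.norm_eq_abs, abs_of_nonneg (Real.smoothTransition.nonneg _)]; exact Real.smoothTransition.le_one _
  obtain ⟨CT, -, hCT⟩ := LeiZhang2011.exists_abs_deriv_smoothTransition_le
  -- the four limit integrands are integrable
  have iT : Integrable fun z : ℝ × EuclideanSpace ℝ (Fin 3) => Φ z.1 z.2 * timeDeriv η z.1 z.2 :=
    integrable_mul_timeDeriv (U := W) (g := fun z => Φ z.1 z.2) hΦc hη
  have iU : Integrable fun z : ℝ × EuclideanSpace ℝ (Fin 3) => Φ z.1 z.2 * fderiv ℝ (η z.1) z.2 (U z.1 z.2) := by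
    have hLc : Continuous fun z : ℝ × EuclideanSpace ℝ (Fin 3) => Φ z.1 z.2 • fderiv ℝ (η z.1) z.2 :=
      continuous_smul_of_eq_zero_off hWo hKc hKW hΦc hDc hD0
    have hL0 : ∀ z : ℝ × EuclideanSpace ℝ (Fin 3), z ∉ K → Φ z.1 z.2 • fderiv ℝ (η z.1) z.2 = 0 := fun z hz => by
      rw [hD0 z hz, smul_zero]
    obtain ⟨C, hC⟩ := hLc.bounded_above_of_compact_support (HasCompactSupport.intro hKc hL0)
    exact (integrable_clm_apply_drift hKc hLc.aestronglyMeasurable hC hL0 hUm hU1).congr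
      (Eventually.of_forall fun z => by simp only [_root_.smul_apply, smul_eq_mul])
  have iB : Integrable fun z : ℝ × EuclideanSpace ℝ (Fin 3) => Φ z.1 z.2 * (2 / cylRadius z.2 * partialDeriv (eR z.2) (η z.1) z.2) := by
    have h := integrable_mul_axisDrift_apply hKc (Φ := fun z => Φ z.1 z.2) hΦm hMΦ hDc hCD hD0
    simpa only [partialDeriv_apply] using h
  have iL : Integrable fun z : ℝ × EuclideanSpace ℝ (Fin 3) => Laplacian.laplacian (Φ z.1) z.2 * η z.1 z.2 :=
    integrable_mul_test hΦΔ hη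
  -- the `ε`-level terms
  set I₁ : ℝ → ℝ := fun ε => ∫ z : ℝ × EuclideanSpace ℝ (Fin 3), Φ z.1 z.2 * timeDeriv η z.1 z.2 * ψ ε z.2 with hI₁
  set I₃ : ℝ → ℝ := fun ε => ∫ z : ℝ × EuclideanSpace ℝ (Fin 3), Φ z.1 z.2 * fderiv ℝ (η z.1) z.2 (U z.1 z.2) * ψ ε z.2 with hI₃
  set E : ℝ → ℝ := fun ε => ∫ z : ℝ × EuclideanSpace ℝ (Fin 3), F z * fderiv ℝ (ψ ε) z.2 (U z.1 z.2) with hE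
  set I₄ : ℝ → ℝ := fun ε => ∫ z : ℝ × EuclideanSpace ℝ (Fin 3),
    Φ z.1 z.2 * (2 / cylRadius z.2 * partialDeriv (eR z.2) (η z.1) z.2) * ψ ε z.2 with hI₄
  set A : ℝ → ℝ := fun ε => ∫ z : ℝ × EuclideanSpace ℝ (Fin 3),
    F z * (2 / cylRadius z.2 * (deriv Real.smoothTransition (2 / ε * cylRadius z.2 - 1) * (2 / ε))) with hA
  set T : ℝ → ℝ := fun ε => ∫ z : ℝ × EuclideanSpace ℝ (Fin 3), Laplacian.laplacian (Φ z.1) z.2 * η z.1 z.2 * ψ ε z.2 with hT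
  -- Step A/B: the off-axis inequality tested with `η ψ_ε`, expanded
  have hstep : ∀ ε, 0 < ε → 0 ≤ -I₁ ε - (I₃ ε + E ε) - (I₄ ε + A ε) - T ε := by
    intro ε hε
    obtain ⟨hsmooth, -⟩ := axisCutoff_props hε hCT (hψ ε)
    have hχ : IsSpaceTimeTestOn V (fun t x => η t x * ψ ε x) :=
      isSpaceTimeTestOn_mul_axisCutoff hη hε (hψ ε) (fun z hz => hz)
    have h := veryWeak_supersolution_offAxis V hVρ Φ U (hΦc.mono hVW) (fun z hz => hΦs z (hVW hz)) (hΦg.mono hVW)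
      (hΦΔ.mono hVW) (fun z hz => hΦt z hz.1 hz.2) hΦt' hUc (fun z hz => hUs z hz.1 hz.2)
      (fun z hz => hdivU z hz.1 hz.2) (fun z hz => hsup z hz.1 hz.2) _ hχ
      (fun t x => mul_nonneg (hη0 t x) (Real.smoothTransition.nonneg _))
    -- (B1) time derivative
    have e1 : ∫ z : ℝ × EuclideanSpace ℝ (Fin 3), Φ z.1 z.2 * timeDeriv (fun t x => η t x * ψ ε x) z.1 z.2 = I₁ ε := by
      refine integral_congr_ae (Eventually.of_forall fun z => ?_)
      simp only [timeDeriv_mul_axisCutoff]; ring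
    -- (B2) the drift `U`
    have iE : Integrable fun z : ℝ × EuclideanSpace ℝ (Fin 3) => F z * fderiv ℝ (ψ ε) z.2 (U z.1 z.2) := by
      have hDψ : Continuous fun z : ℝ × EuclideanSpace ℝ (Fin 3) => fderiv ℝ (ψ ε) z.2 :=
        (hsmooth.continuous_fderiv (by simp)).comp continuous_snd
      have hLc : Continuous fun z : ℝ × EuclideanSpace ℝ (Fin 3) => F z • fderiv ℝ (ψ ε) z.2 := hFc.smul hDψ
      have hL0 : ∀ z : ℝ × EuclideanSpace ℝ (Fin 3), z ∉ K → F z • fderiv ℝ (ψ ε) z.2 = 0 := fun z hz => by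
        rw [hF0 z hz, zero_smul]
      obtain ⟨C, hC⟩ := hLc.bounded_above_of_compact_support (HasCompactSupport.intro hKc hL0)
      exact (integrable_clm_apply_drift hKc hLc.aestronglyMeasurable hC hL0 hUm hU1).congr
        (Eventually.of_forall fun z => by simp only [_root_.smul_apply, smul_eq_mul])
    have e2 : ∫ z : ℝ × EuclideanSpace ℝ (Fin 3), Φ z.1 z.2 * fderiv ℝ (fun x => η z.1 x * ψ ε x) z.2 (U z.1 z.2) = I₃ ε + E ε := by
      rw [hI₃, hE]; beta_reduce
      rw [← integral_add (iU.mul_bdd (hψm ε) (hψ1 ε)) iE]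
      refine integral_congr_ae (Eventually.of_forall fun z => ?_)
      simp only [fderiv_mul_axisCutoff_apply hη hε (hψ ε), hF]; ring
    -- (B3) the singular drift
    have iA : Integrable fun z : ℝ × EuclideanSpace ℝ (Fin 3) =>
        F z * (2 / cylRadius z.2 * (deriv Real.smoothTransition (2 / ε * cylRadius z.2 - 1) * (2 / ε))) :=
      integrable_mul_axisDrift_axisCutoff hKc hFc hF0 hε
    have e3 : ∫ z : ℝ × EuclideanSpace ℝ (Fin 3), Φ z.1 z.2 * (2 / cylRadius z.2 *
        partialDeriv (eR z.2) (fun x => η z.1 x * ψ ε x) z.2) = I₄ ε + A ε := by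
      rw [hI₄, hA]; beta_reduce
      rw [← integral_add (iB.mul_bdd (hψm ε) (hψ1 ε)) iA]
      refine integral_congr_ae (Eventually.of_forall fun z => ?_)
      simp only [partialDeriv_apply, fderiv_mul_axisCutoff_apply hη hε (hψ ε), fderiv_axisCutoff_apply_eR (hψ ε), hF]
      ring
    -- (B4) the Laplacian
    have e4 : ∫ z : ℝ × EuclideanSpace ℝ (Fin 3), Laplacian.laplacian (Φ z.1) z.2 * (η z.1 z.2 * ψ ε z.2) = T ε := by
      refine integral_congr_ae (Eventually.of_forall fun z => ?_); ring
    rw [e1, e2, e3, e4] at h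
    exact h
  -- Step C: the limits `ε → 0⁺`
  have hI₁ : Tendsto I₁ (𝓝[>] 0) (𝓝 (∫ z : ℝ × EuclideanSpace ℝ (Fin 3), Φ z.1 z.2 * timeDeriv η z.1 z.2)) :=
    tendsto_integral_mul_axisCutoff iT
  have hI₃ : Tendsto I₃ (𝓝[>] 0) (𝓝 (∫ z : ℝ × EuclideanSpace ℝ (Fin 3), Φ z.1 z.2 * fderiv ℝ (η z.1) z.2 (U z.1 z.2))) :=
    tendsto_integral_mul_axisCutoff iU
  have hI₄ : Tendsto I₄ (𝓝[>] 0) (𝓝 (∫ z : ℝ × EuclideanSpace ℝ (Fin 3),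
      Φ z.1 z.2 * (2 / cylRadius z.2 * partialDeriv (eR z.2) (η z.1) z.2))) :=
    tendsto_integral_mul_axisCutoff iB
  have hTl : Tendsto T (𝓝[>] 0) (𝓝 (∫ z : ℝ × EuclideanSpace ℝ (Fin 3), Φ z.1 z.2 * Laplacian.laplacian (η z.1) z.2)) := by
    rw [← integral_laplacian_mul_test_eq W Φ hΦc hΦs hΦg hΦ2 η hη]
    exact tendsto_integral_mul_axisCutoff iL
  have hEl : Tendsto E (𝓝[>] 0) (𝓝 0) :=
    tendsto_integral_driftCommutator hKc hFc.aestronglyMeasurable hMF hF0 hUm hUρ hψ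
  have hAl : Tendsto A (𝓝[>] 0) (𝓝 (2 * radialConst₂ * ∫ p : ℝ × ℝ, F (p.1, meridianPoint (0, p.2)))) :=
    tendsto_integral_spaceTime_axisTerm hFc hFs
  -- Step D: pass to the limit in the inequality
  have hlim := ((hI₁.neg.sub (hI₃.add hEl)).sub (hI₄.add hAl)).sub hTl
  have hge := ge_of_tendsto hlim (eventually_nhdsWithin_of_forall fun ε hε => hstep ε hε)
  rw [radialConst₂_eq_two_mul_pi] at hge
  have eF : ∫ p : ℝ × ℝ, F (p.1, meridianPoint (0, p.2)) = ∫ p : ℝ × ℝ, Φ p.1 (meridianPoint (0, p.2)) * η p.1 (meridianPoint (0, p.2)) := rfl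
  rw [eF] at hge
  linarith

/-- **The very weak form with the lower bound on the axis** (Seregin's display in the form
consumed by Nazarov–Uraltseva's (4.6)–(4.8): "Then (4.5) and `V|_{Γ∩Q} ≥ k` imply
`(π/2)kR³ ≤ ∫∫ V(|∂ₜη| + |Δη| + |b|·|Dη|)`"). Same setting as
`veryWeak_supersolution_axis`; if moreover `k ≤ Φ` at the axis points of `tsupport η`
((2.13) on the regular part of the axis), then
`4π k ∫∫ η(t, (0,0,x₃)) dx₃ dt ≤ -∫∫ Φ ∂ₜη - ∫∫ Φ Dη[U] - ∫∫ Φ (2/ϱ)∂_ϱη - ∫∫ Φ Δη`.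
[cite: Seregin2020, proof of Lemma 2.2 (arXiv p. 8), the displayed inequality combined with (2.13); NazarovUraltseva2012 (4.5)–(4.6)] -/
theorem veryWeak_supersolution_axis_lowerBound : ∀ (W : Opens (ℝ × EuclideanSpace ℝ (Fin 3)))
    (Φ : ℝ → EuclideanSpace ℝ (Fin 3) → ℝ) (U : ℝ → EuclideanSpace ℝ (Fin 3) → EuclideanSpace ℝ (Fin 3)),
    ContinuousOn (uncurry Φ) (W : Set (ℝ × EuclideanSpace ℝ (Fin 3))) →
    (∀ z ∈ (W : Set (ℝ × EuclideanSpace ℝ (Fin 3))), ContDiffAt ℝ 2 (Φ z.1) z.2) →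
    ContinuousOn (fun z : ℝ × EuclideanSpace ℝ (Fin 3) => fderiv ℝ (Φ z.1) z.2) (W : Set (ℝ × EuclideanSpace ℝ (Fin 3))) →
    (∀ e : EuclideanSpace ℝ (Fin 3), ContinuousOn
      (fun z : ℝ × EuclideanSpace ℝ (Fin 3) => fderiv ℝ (fun y => fderiv ℝ (Φ z.1) y e) z.2 e)
      (W : Set (ℝ × EuclideanSpace ℝ (Fin 3)))) →
    (∀ z ∈ (W : Set (ℝ × EuclideanSpace ℝ (Fin 3))), cylRadius z.2 ≠ 0 → DifferentiableAt ℝ (fun r => Φ r z.2) z.1) →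
    ContinuousOn (fun z : ℝ × EuclideanSpace ℝ (Fin 3) => deriv (fun r => Φ r z.2) z.1)
      ((W : Set (ℝ × EuclideanSpace ℝ (Fin 3))) ∩ {z | cylRadius z.2 ≠ 0}) →
    ContinuousOn (uncurry U) ((W : Set (ℝ × EuclideanSpace ℝ (Fin 3))) ∩ {z | cylRadius z.2 ≠ 0}) →
    (∀ z ∈ (W : Set (ℝ × EuclideanSpace ℝ (Fin 3))), cylRadius z.2 ≠ 0 → ContDiffAt ℝ 1 (U z.1) z.2) →
    (∀ z ∈ (W : Set (ℝ × EuclideanSpace ℝ (Fin 3))), cylRadius z.2 ≠ 0 → VectorCalculus.divergence (U z.1) z.2 = 0) →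
    (∀ z ∈ (W : Set (ℝ × EuclideanSpace ℝ (Fin 3))), cylRadius z.2 ≠ 0 →
      0 ≤ deriv (fun r => Φ r z.2) z.1 + fderiv ℝ (Φ z.1) z.2 (U z.1 z.2) +
        2 / cylRadius z.2 * partialDeriv (eR z.2) (Φ z.1) z.2 - Laplacian.laplacian (Φ z.1) z.2) →
    ∀ (η : ℝ → EuclideanSpace ℝ (Fin 3) → ℝ), IsSpaceTimeTestOn W η → (∀ t x, 0 ≤ η t x) →
    (∫⁻ z in tsupport (uncurry η), ‖U z.1 z.2‖ₑ ^ (3 : ℕ) < ∞) →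
    ∀ k : ℝ, (∀ z ∈ tsupport (uncurry η), cylRadius z.2 = 0 → k ≤ Φ z.1 z.2) →
    4 * Real.pi * k * ∫ p : ℝ × ℝ, η p.1 (meridianPoint (0, p.2)) ≤
      -(∫ z : ℝ × EuclideanSpace ℝ (Fin 3), Φ z.1 z.2 * timeDeriv η z.1 z.2)
        - (∫ z : ℝ × EuclideanSpace ℝ (Fin 3), Φ z.1 z.2 * fderiv ℝ (η z.1) z.2 (U z.1 z.2))
        - (∫ z : ℝ × EuclideanSpace ℝ (Fin 3), Φ z.1 z.2 * (2 / cylRadius z.2 * partialDeriv (eR z.2) (η z.1) z.2))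
        - ∫ z : ℝ × EuclideanSpace ℝ (Fin 3), Φ z.1 z.2 * Laplacian.laplacian (η z.1) z.2 := by
  intro W Φ U hΦc hΦs hΦg hΦ2 hΦt hΦt' hUc hUs hdivU hsup η hη hη0 hU3 k hk
  have hmain := veryWeak_supersolution_axis W Φ U hΦc hΦs hΦg hΦ2 hΦt hΦt' hUc hUs hdivU hsup η hη hη0 hU3
  obtain ⟨hFc, hF0⟩ := continuous_mul_test_of_continuousOn hΦc hη
  have hFs : HasCompactSupport fun z : ℝ × EuclideanSpace ℝ (Fin 3) => Φ z.1 z.2 * η z.1 z.2 :=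
    HasCompactSupport.intro hη.hasCompactSupport hF0
  have iF := integrable_comp_axis hFc hFs
  have iη : Integrable fun p : ℝ × ℝ => η p.1 (meridianPoint (0, p.2)) :=
    integrable_comp_axis (F := uncurry η) hη.contDiff.continuous hη.hasCompactSupport
  have hax : ∀ s : ℝ, cylRadius (meridianPoint (0, s) : EuclideanSpace ℝ (Fin 3)) = 0 := fun s => by
    rw [cylRadius_meridianPoint_eq_abs, abs_zero]
  have hmono : ∫ p : ℝ × ℝ, k * η p.1 (meridianPoint (0, p.2)) ≤
      ∫ p : ℝ × ℝ, Φ p.1 (meridianPoint (0, p.2)) * η p.1 (meridianPoint (0, p.2)) := by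
    refine integral_mono (iη.const_mul k) iF fun p => ?_
    by_cases hp : ((p.1, meridianPoint (0, p.2)) : ℝ × EuclideanSpace ℝ (Fin 3)) ∈ tsupport (uncurry η)
    · exact mul_le_mul_of_nonneg_right (hk _ hp (hax p.2)) (hη0 _ _)
    · have h0 : η p.1 (meridianPoint (0, p.2)) = 0 := (image_eq_zero_of_notMem_tsupport hp : uncurry η _ = 0)
      simp [h0]
  rw [integral_const_mul] at hmono
  have hπ : 0 ≤ 4 * Real.pi := by positivity
  calc 4 * Real.pi * k * ∫ p : ℝ × ℝ, η p.1 (meridianPoint (0, p.2))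
      = 4 * Real.pi * (k * ∫ p : ℝ × ℝ, η p.1 (meridianPoint (0, p.2))) := by ring
    _ ≤ 4 * Real.pi * ∫ p : ℝ × ℝ, Φ p.1 (meridianPoint (0, p.2)) * η p.1 (meridianPoint (0, p.2)) :=
        mul_le_mul_of_nonneg_left hmono hπ
    _ ≤ _ := hmain

end Summit.NavierStokesRegularity.NavierStokesRegularity.Theorems.AxisymmetricKatoGlobal.EulerScaling

end
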